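import Summits.SmoothPoincare4.SmoothPoincare4.Theses.SullivanDual
import Summits.SmoothPoincare4.SmoothPoincare4.Theorems.SullivanDualHyperbolicEndTaubesModelDefs
import Literature.Geometry.Symplectic.NearSymplecticPuncturedSphere

/-!
# Route `SullivanDual`, crux `HyperbolicEnd` (stmt-SmoothPoincare4-7825), line `taubes-circle-pencil`:
# stub S1 `stub_nearSymplecticData` staged on the named fact `relNearSymplecticTaubesTubes_exists`

Stub S1 of the checked skeleton `Cruxes/HyperbolicEnd/Lines/taubes_circle_pencil.lean` asks, for every
homotopy 4-sphere `Σ` and `p ∈ Σ`, for relative near-symplectic data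
`IsNearSymplecticData p ε δ sf Ψ₁ Ψ₂` (`Theorems/SullivanDualHyperbolicEndTaubesModelDefs.lean`): a
smooth closed `2`-form `sf` on `Σ ∖ p` equal to the inverted-chart model `ι*ω₀` on a punctured
`ε`-chart-ball, two disjoint Taubes tubes `Ψ₁, Ψ₂` (smooth injective immersions of the flat solid
torus `taubesTube δ` avoiding the ball, `Ψᵢ* sf = taubesForm`) and `sf` non-degenerate off the tube
images.  This is TRUE IN PRINT — Gerig, AGT 21 (2021) Thm. 1.6 (asymptotically standard
near-symplectic forms on `Σ ∖ pt`) + Luttinger / Perutz, JSG 4 (2006) (exactly two untwisted zero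
circles) + Honda, Crelle 577 (2004) Thm. 5 = Taubes, GT 2 (1998) eq. (1.1), §1.c (exact model along
an untwisted circle after a local deformation) — and XL formally (Hodge theory with cylindrical ends,
Moser-type normal forms: absent from Mathlib and the tree).  The published input is vendored as the
Literature named fact `Literature.Geometry.Symplectic.relNearSymplecticTaubesTubes_exists`
(`Literature/Geometry/Symplectic/NearSymplecticPuncturedSphere.lean`, whose module docstring spells
the derivation), stated over Literature vocabulary only (`IsStandardOnBall`, the model form / tube /
core written out, non-degeneracy off the two CORE circles).

This file proves the STAGING theorem (registered helper)
`helper_nearSymplecticData_of_relNearSymplecticTaubesTubes`: the named fact implies the stub's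
statement verbatim.  The proof is a repackaging — every clause of the fact is a field of
`IsNearSymplecticData` up to `δ`-unfolding of `taubesForm` / `taubesTube` / `IsStandardOnBall`
(checked by the kernel: the fact's inlined formula IS `taubesForm`), and non-degeneracy off the
tubes follows from non-degeneracy off the cores by `taubesCore ⊆ taubesTube δ`
(`helper_taubesCore_subset_tube`).  The stub itself stays open modulo the fact (a stub cannot be
closed conditionally).
-/

-- the registered namespace `Summit.SmoothPoincare4.SmoothPoincare4.…` repeats a component (P = Sub)
set_option linter.dupNamespace false

noncomputable section

open scoped Manifold ContDiff Topology
open Set Literature.Geometry.Kaehler Literature.Geometry.Symplectic Literature.Topology.FourManifolds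

namespace Summit.SmoothPoincare4.SmoothPoincare4.Cruxes.HyperbolicEnd.TaubesCirclePencil

-- registered signature, verbatim on one line (gate matches name + header textually)
/-- **Stub S1 modulo the literature.**  The named fact
`Literature.Geometry.Symplectic.relNearSymplecticTaubesTubes_exists` (Gerig 2021 Thm. 1.6 +
Perutz 2006 / Luttinger + Honda 2004 Thm. 5, end result: a near-symplectic form on `Σ ∖ p`,
standard on a punctured chart-ball, with two untwisted Taubes model tubes and non-degenerate off
the two core circles) implies the statement of `stub_nearSymplecticData` VERBATIM: for every
homotopy 4-sphere `Σ` and `p ∈ Σ` there are `ε, δ, sf, Ψ₁, Ψ₂` with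
`IsNearSymplecticData p ε δ sf Ψ₁ Ψ₂`.  Field by field the fact's clauses are the package's
clauses (`IsStandardOnBall` is `eq_inverted`; the inlined model form, tube and core are
`taubesForm`, `taubesTube δ`, `taubesCore` by `rfl`), and non-degeneracy off the cores gives
non-degeneracy off the tubes since `taubesCore ⊆ taubesTube δ` for `0 < δ`. [folklore] -/
theorem helper_nearSymplecticData_of_relNearSymplecticTaubesTubes : Literature.Geometry.Symplectic.relNearSymplecticTaubesTubes_exists → ∀ (S : HomotopySphere 4) (p : S.carrier), ∃ (ε δ : ℝ) (sf : MForm (𝓡 4) ↥(punctured p) ℝ 2) (Ψ₁ Ψ₂ : EuclideanSpace ℝ (Fin 4) → ↥(punctured p)), IsNearSymplecticData p ε δ sf Ψ₁ Ψ₂ := by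
  intro h S p
  obtain ⟨ε, δ, sf, Ψ₁, Ψ₂, hε, hball, hδ, hδ1, hsm, hcl, hstd, hT₁, hT₂, hdisj, hnd⟩ := h S p
  refine ⟨ε, δ, sf, Ψ₁, Ψ₂, ?_⟩
  exact
    { ε_pos := hε
      closedBall_subset := hball
      δ_pos := hδ
      δ_lt_one := hδ1
      smooth := hsm
      closed := hcl
      eq_inverted := hstd
      tube₁ := ⟨hT₁.1, hT₁.2.1, hT₁.2.2.1, hT₁.2.2.2.1, hT₁.2.2.2.2⟩
      tube₂ := ⟨hT₂.1, hT₂.2.1, hT₂.2.2.1, hT₂.2.2.2.1, hT₂.2.2.2.2⟩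
      disjoint := hdisj
      nondegenerate := fun x hx v hv => hnd x (fun hx' => hx (by
        rcases hx' with hx' | hx'
        · exact Or.inl (Set.image_mono (helper_taubesCore_subset_tube δ hδ) hx')
        · exact Or.inr (Set.image_mono (helper_taubesCore_subset_tube δ hδ) hx'))) v hv }

end Summit.SmoothPoincare4.SmoothPoincare4.Cruxes.HyperbolicEnd.TaubesCirclePencil

end
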